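import Mathlib.NumberTheory.Chebyshev
import Mathlib.Analysis.SpecialFunctions.Pow.Real
import Literature.NumberTheory.Sieve.GranvilleGoldbach
import Literature.NumberTheory.Sieve.LinearEquationsInPrimesTransference
import HarnessLib

/-!
# Granville's averaged Goldbach count: the summatory function `∑_{N ≤ x} G(N)`

Support file for the discharge of the named fact `Literature.NumberTheory.Sieve.granville_thm1A`
(`Literature/NumberTheory/Sieve/GranvilleGoldbach.lean`; A. Granville, Funct. Approx. Comment.
Math. 37 (2007), Theorem 1A: RH `↔ ∑_{N ≤ x, N even} (G(N) − J(N)) ≪ x^{3/2+o(1)}` with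
`G(N) = ∑_{p+q=N} log p log q`).

This file contains the elementary, prime-number-theoretic half of the argument, for the
summatory function over *all* `N ≤ x`,

* `goldbachLogSum x = ∑_{N ≤ x} G(N) = ∑_{a ≤ x} w(a) θ(x − a)` (`w = Λ'`, i.e. `log p` on
  primes and `0` elsewhere, is the tree's `Literature.NumberTheory.Sieve.vonMangoldtPrime` from
  `LinearEquationsInPrimesTransference.lean`; `θ` = `Chebyshev.theta`),
  `goldbachLogSum_eq_sum_vonMangoldtPrime_mul_theta`;
* Abel summation `∑_{a ≤ x} w(a) (x − a) = ∑_{n < x} θ(n)` (`sum_range_mul_sub_eq`);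
* the odd `N` contribute `O(x^{3/2})` in total: for odd `N` one of `p, q` is `2`, so
  `G(N) ≤ 2 log 2 · log N` (`goldbachLogCount_le_of_odd`, `sum_odd_goldbachLogCount_le`);
* the forward estimate in conditional form (under RH, `∑_{n ≤ x} G(n) = x²/2 + O(x^{3/2})` is
  due to Fujii 1991 and Granville 2007, cf. Bhowmik–Ruzsa 2018, §1, eq. (1); here we derive the
  slightly weaker form needed for Theorem 1A from a uniform bound for `θ(n) − n`): if
  `|θ(n) − n| ≤ A (n+1)^α` for all `n`, then
  `|∑_{N ≤ x} G(N) − x²/2| ≤ (A log 4 + A + 1) (x+1)^{α+1}`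
  (`abs_goldbachLogSum_sub_le`). With von Koch's theorem (`α = 1/2 + ε`) this is the direction
  RH `⇒ ∑_{N ≤ x} G(N) = x²/2 + O(x^{3/2+ε})`, assembled in `GranvilleGoldbachProofs.lean`;
* `θ(n)`, `ψ(n)` at natural arguments as sums over `range (n+1)` (`theta_natCast`,
  `psi_natCast`; the latter is consumed by the power-series step in
  `GranvilleGoldbachConverse.lean`). These two restate `Literature.NumberTheory.Sieve.chebyshevTheta_natCast_eq_sum_range`
  / `Literature.NumberTheory.Sieve.chebyshevPsi_natCast_eq_sum_range` of `LevelOfDistributionProofs.lean`, whose import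
  closure (PNT error term) is too heavy for this file; local copies, librarian may merge.

## References

* A. Granville, *Refinements of Goldbach's conjecture, and the generalized Riemann hypothesis*,
  Funct. Approx. Comment. Math. 37 (2007), 159–173, Theorem 1A; corrigendum 38 (2008).
* G. Bhowmik, I. Z. Ruzsa, *Average Goldbach and the quasi-Riemann hypothesis*, Anal. Math. 44
  (2018), 51–56, §1, eq. (1) (the summatory function `S(x) = ∑_{n ≤ x} G(n)` and its
  asymptotics under RH).
* A. Fujii, *An additive problem of prime numbers*, Acta Arith. 58 (1991), 173–179.
-/

noncomputable section

open Filter Finset Asymptotics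
open scoped Chebyshev ArithmeticFunction.vonMangoldt

namespace Literature.NumberTheory.Sieve

namespace GoldbachAverage

/-! ### The prime weight `w = Λ'` (`Literature.NumberTheory.Sieve.vonMangoldtPrime`) -/

/-- Unfolding lemma for the tree's `Λ'` (`Literature.vonMangoldtPrime n = if n.Prime then log n else 0`,
`Literature/NumberTheory/Sieve/LinearEquationsInPrimesTransference.lean`), Granville's weight:
`G(N) = ∑_{a+b=N} Λ'(a) Λ'(b)` and `θ(x) = ∑_{n ≤ x} Λ'(n)`. [folklore] -/
theorem vonMangoldtPrime_apply (n : ℕ) : vonMangoldtPrime n = if n.Prime then Real.log n else 0 :=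
  rfl

/-- `Λ'(p) = log p` at a prime (cf. `Literature.NumberTheory.Sieve.vonMangoldtPrime_prime`, which rewrites to `Λ p`).
[folklore] -/
theorem vonMangoldtPrime_eq_log {p : ℕ} (hp : p.Prime) : vonMangoldtPrime p = Real.log p :=
  if_pos hp

/-- `Λ' ≥ 0`. [folklore] -/
theorem vonMangoldtPrime_nonneg (n : ℕ) : 0 ≤ vonMangoldtPrime n :=
  (vonMangoldtPrime_le_vonMangoldt n).1

/-- `Λ'(n) ≤ log n`. [folklore] -/
theorem vonMangoldtPrime_le_log (n : ℕ) : vonMangoldtPrime n ≤ Real.log n :=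
  (vonMangoldtPrime_le_vonMangoldt n).2.trans ArithmeticFunction.vonMangoldt_le_log

/-- `Λ'(n) ≤ n`. [folklore] -/
theorem vonMangoldtPrime_le_self (n : ℕ) : vonMangoldtPrime n ≤ n :=
  (vonMangoldtPrime_le_log n).trans (Real.log_le_self n.cast_nonneg)

/-- `|Λ'(n)| ≤ 1 · (n + 1)^1` (the polynomial bound used for power series). [folklore] -/
theorem abs_vonMangoldtPrime_le (n : ℕ) : |vonMangoldtPrime n| ≤ 1 * ((n : ℝ) + 1) ^ 1 := by
  rw [abs_of_nonneg (vonMangoldtPrime_nonneg n), one_mul, pow_one]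
  linarith [vonMangoldtPrime_le_self n]

/-- Granville's `G(N)` (`Literature.NumberTheory.Sieve.goldbachLogCount`) is the antidiagonal sum of `Λ'(a) Λ'(b)`.
[folklore] -/
theorem goldbachLogCount_eq_sum_vonMangoldtPrime (N : ℕ) :
    goldbachLogCount N = ∑ ab ∈ antidiagonal N, vonMangoldtPrime ab.1 * vonMangoldtPrime ab.2 := by
  unfold goldbachLogCount
  refine sum_congr rfl fun ab _ ↦ ?_
  by_cases h1 : ab.1.Prime <;> by_cases h2 : ab.2.Prime <;> simp [vonMangoldtPrime_apply, h1, h2]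

/-- `G(N) ≥ 0`. [folklore] -/
theorem goldbachLogCount_nonneg (N : ℕ) : 0 ≤ goldbachLogCount N := by
  rw [goldbachLogCount_eq_sum_vonMangoldtPrime]
  exact sum_nonneg fun ab _ ↦ mul_nonneg (vonMangoldtPrime_nonneg _) (vonMangoldtPrime_nonneg _)

/-- `G(N) ≤ (N+1)^3` (crude polynomial bound: `N + 1` terms, each `≤ N²`). [folklore] -/
theorem goldbachLogCount_le_pow (N : ℕ) : goldbachLogCount N ≤ ((N : ℝ) + 1) ^ 3 := by
  rw [goldbachLogCount_eq_sum_vonMangoldtPrime]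
  have hterm : ∀ ab ∈ antidiagonal N,
      vonMangoldtPrime ab.1 * vonMangoldtPrime ab.2 ≤ ((N : ℝ) + 1) ^ 2 := by
    intro ab hab
    rw [HasAntidiagonal.mem_antidiagonal] at hab
    have ha : (ab.1 : ℝ) ≤ N := by exact_mod_cast hab ▸ Nat.le_add_right ab.1 ab.2
    have hb : (ab.2 : ℝ) ≤ N := by exact_mod_cast hab ▸ Nat.le_add_left ab.2 ab.1
    have h1 := vonMangoldtPrime_le_self ab.1
    have h2 := vonMangoldtPrime_le_self ab.2
    calc vonMangoldtPrime ab.1 * vonMangoldtPrime ab.2 ≤ (N : ℝ) * N :=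
          mul_le_mul (h1.trans ha) (h2.trans hb) (vonMangoldtPrime_nonneg _) N.cast_nonneg
      _ ≤ ((N : ℝ) + 1) ^ 2 := by nlinarith
  calc ∑ ab ∈ antidiagonal N, vonMangoldtPrime ab.1 * vonMangoldtPrime ab.2
      ≤ ∑ ab ∈ antidiagonal N, ((N : ℝ) + 1) ^ 2 := sum_le_sum hterm
    _ = ((N : ℝ) + 1) * ((N : ℝ) + 1) ^ 2 := by
        rw [sum_const, Nat.card_antidiagonal, nsmul_eq_mul]
        push_cast
        ring
    _ = ((N : ℝ) + 1) ^ 3 := by ring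

/-- `|G(N)| ≤ 1 · (N+1)^3`. [folklore] -/
theorem abs_goldbachLogCount_le (N : ℕ) : |goldbachLogCount N| ≤ 1 * ((N : ℝ) + 1) ^ 3 := by
  rw [abs_of_nonneg (goldbachLogCount_nonneg N), one_mul]
  exact goldbachLogCount_le_pow N

/-! ### `θ` and `ψ` at natural arguments -/

/-- `θ(n) = ∑_{k ≤ n} Λ'(k)` for `n : ℕ`. Same statement (after unfolding `Λ'`) as
`Literature.NumberTheory.Sieve.chebyshevTheta_natCast_eq_sum_range` (`LevelOfDistributionProofs.lean`, not imported here
because of its heavy import closure); local copy, librarian may merge. [folklore] -/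
theorem theta_natCast (n : ℕ) : θ (n : ℝ) = ∑ k ∈ range (n + 1), vonMangoldtPrime k := by
  rw [Chebyshev.theta_eq_sum_Icc, Nat.floor_natCast, ← Nat.range_succ_eq_Icc_zero, sum_filter]
  rfl

/-- `ψ(n) = ∑_{k ≤ n} Λ(k)` for `n : ℕ` (used by the power-series step of
`GranvilleGoldbachConverse.lean`). Identical to `Literature.NumberTheory.Sieve.chebyshevPsi_natCast_eq_sum_range`
(`LevelOfDistributionProofs.lean`, not imported here because of its heavy import closure); local
copy, librarian may merge. [folklore] -/
theorem psi_natCast (n : ℕ) : ψ (n : ℝ) = ∑ k ∈ range (n + 1), Λ k := by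
  rw [Chebyshev.psi_eq_sum_Icc, Nat.floor_natCast, ← Nat.range_succ_eq_Icc_zero]

/-! ### The summatory function `S(x) = ∑_{N ≤ x} G(N)` -/

/-- `S(x) = ∑_{N ≤ x} G(N)`, the summatory function of Granville's `G` over all `N ≤ x`
(Bhowmik–Ruzsa's `S(x)`, eq. (1), here with Granville's prime weights `log p log q` instead of
`Λ(k₁)Λ(k₂)`). [cite: BhowmikRuzsa2018, §1 (1)] -/
def goldbachLogSum (x : ℕ) : ℝ := ∑ N ∈ range (x + 1), goldbachLogCount N

/-- Unfolding lemma for `goldbachLogSum`. [folklore] -/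
theorem goldbachLogSum_def (x : ℕ) :
    goldbachLogSum x = ∑ N ∈ range (x + 1), goldbachLogCount N := rfl

/-- Summing an antidiagonal convolution over `N ≤ x` gives a weighted sum of partial sums:
`∑_{N ≤ x} ∑_{a+b=N} f(a) g(b) = ∑_{a ≤ x} f(a) ∑_{b ≤ x−a} g(b)`. [folklore] -/
theorem sum_range_sum_antidiagonal (f g : ℕ → ℝ) (x : ℕ) :
    ∑ N ∈ range (x + 1), ∑ ab ∈ antidiagonal N, f ab.1 * g ab.2 =
      ∑ a ∈ range (x + 1), f a * ∑ b ∈ range (x - a + 1), g b := by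
  induction x with
  | zero => simp
  | succ x ih =>
    rw [sum_range_succ, ih, Nat.sum_antidiagonal_eq_sum_range_succ (fun a b ↦ f a * g b),
      sum_range_succ (fun a ↦ f a * ∑ b ∈ range (x + 1 - a + 1), g b),
      sum_range_succ (fun k ↦ f k * g (x + 1 - k))]
    have h1 : ∀ a ∈ range (x + 1), f a * ∑ b ∈ range (x + 1 - a + 1), g b =
        f a * ∑ b ∈ range (x - a + 1), g b + f a * g (x + 1 - a) := by
      intro a ha
      have hax : a ≤ x := Nat.lt_succ_iff.mp (mem_range.mp ha)
      rw [show x + 1 - a + 1 = (x - a + 1) + 1 by omega, sum_range_succ,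
        show x + 1 - a = x - a + 1 by omega]
      ring
    rw [sum_congr rfl h1, sum_add_distrib]
    simp only [Nat.sub_self, zero_add, sum_range_one]
    ring

/-- **`S(x) = ∑_{a ≤ x} w(a) θ(x − a)`** (collect the pairs `a + b ≤ x` according to `a`).
[folklore] -/
theorem goldbachLogSum_eq_sum_vonMangoldtPrime_mul_theta (x : ℕ) :
    goldbachLogSum x = ∑ a ∈ range (x + 1), vonMangoldtPrime a * θ ((x - a : ℕ) : ℝ) := by
  simp_rw [goldbachLogSum_def, goldbachLogCount_eq_sum_vonMangoldtPrime, theta_natCast]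
  exact sum_range_sum_antidiagonal vonMangoldtPrime vonMangoldtPrime x

/-- **Abel summation**: `∑_{a ≤ x} f(a) (x − a) = ∑_{n < x} ∑_{a ≤ n} f(a)`. [folklore] -/
theorem sum_range_mul_sub_eq (f : ℕ → ℝ) (x : ℕ) :
    ∑ a ∈ range (x + 1), f a * ((x : ℝ) - a) = ∑ n ∈ range x, ∑ a ∈ range (n + 1), f a := by
  induction x with
  | zero => simp
  | succ x ih =>
    rw [sum_range_succ (fun n ↦ ∑ a ∈ range (n + 1), f a) x, ← ih, ← sum_add_distrib,
      sum_range_succ (fun a ↦ f a * (((x + 1 : ℕ) : ℝ) - a)) (x + 1)]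
    push_cast
    rw [sub_self, mul_zero, add_zero]
    exact sum_congr rfl fun a _ ↦ by ring

/-- The even part of `S(x)`: `∑_{N ≤ x, N even} G(N) = S(x) − ∑_{N ≤ x, N odd} G(N)`. [folklore] -/
theorem sum_even_goldbachLogCount_eq (x : ℕ) :
    ∑ N ∈ (range (x + 1)).filter Even, goldbachLogCount N =
      goldbachLogSum x - ∑ N ∈ (range (x + 1)).filter Odd, goldbachLogCount N := by
  rw [goldbachLogSum_def, ← sum_filter_add_sum_filter_not (range (x + 1)) Even]
  have : (range (x + 1)).filter (fun N ↦ ¬Even N) = (range (x + 1)).filter Odd :=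
    filter_congr fun N _ ↦ Nat.not_even_iff_odd
  rw [this]
  ring

/-! ### Odd `N`: one of the two primes is `2` -/

/-- For odd `N` and `k ≤ N` with `k ≠ 2`, `k ≠ N − 2`: `w(k) w(N − k) = 0` (two odd primes have an
even sum). [folklore] -/
theorem vonMangoldtPrime_mul_vonMangoldtPrime_eq_zero_of_odd {N k : ℕ} (hN : Odd N) (hk : k ≤ N)
    (hk2 : k ≠ 2) (hkN : k ≠ N - 2) : vonMangoldtPrime k * vonMangoldtPrime (N - k) = 0 := by
  by_cases hpk : k.Prime
  · by_cases hpNk : (N - k).Prime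
    · exfalso
      have hko : Odd k := hpk.odd_of_ne_two hk2
      have hNke : Even (N - k) := Nat.Odd.sub_odd hN hko
      have h2 : N - k = 2 := (hpNk.even_iff).mp hNke
      omega
    · rw [vonMangoldtPrime_of_not_prime hpNk, mul_zero]
  · rw [vonMangoldtPrime_of_not_prime hpk, zero_mul]

/-- For every `N ≥ 1` and `k ≤ N`: `w(k) w(N − k) ≤ log N · log N`-type bounds; we only need
`w(2) w(N−2), w(N−2) w(2) ≤ log 2 · log N`. [folklore] -/
theorem vonMangoldtPrime_mul_vonMangoldtPrime_le {N k : ℕ} (hk : k ≤ N) (h : k = 2 ∨ k = N - 2) :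
    vonMangoldtPrime k * vonMangoldtPrime (N - k) ≤ Real.log 2 * Real.log N := by
  have hlogN : 0 ≤ Real.log N := Real.log_natCast_nonneg N
  have hlog2 : 0 ≤ Real.log 2 := Real.log_nonneg (by norm_num)
  have hmono : ∀ m : ℕ, m ≤ N → vonMangoldtPrime m ≤ Real.log N := by
    intro m hm
    rcases Nat.eq_zero_or_pos m with rfl | hm0
    · rw [vonMangoldtPrime_of_not_prime Nat.not_prime_zero]
      exact hlogN
    · exact (vonMangoldtPrime_le_log m).trans
        (Real.log_le_log (by exact_mod_cast hm0) (by exact_mod_cast hm))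
  rcases h with rfl | rfl
  · exact mul_le_mul ((vonMangoldtPrime_le_log 2).trans_eq (by norm_num)) (hmono _ (Nat.sub_le N 2))
      (vonMangoldtPrime_nonneg _) hlog2
  · rcases lt_or_ge N 2 with hN2 | hN2
    · have : N - 2 = 0 := by omega
      rw [this, vonMangoldtPrime_of_not_prime Nat.not_prime_zero, zero_mul]
      exact mul_nonneg hlog2 hlogN
    · have : N - (N - 2) = 2 := by omega
      rw [this, mul_comm]
      exact mul_le_mul ((vonMangoldtPrime_le_log 2).trans_eq (by norm_num))
        (hmono _ (Nat.sub_le N 2)) (vonMangoldtPrime_nonneg _) hlog2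

/-- **Odd `N`: `G(N) ≤ 2 log 2 · log N`** (only the pairs `(2, N−2)`, `(N−2, 2)` can contribute).
[folklore] -/
theorem goldbachLogCount_le_of_odd {N : ℕ} (hN : Odd N) :
    goldbachLogCount N ≤ 2 * Real.log 2 * Real.log N := by
  have hlogN : 0 ≤ Real.log N := Real.log_natCast_nonneg N
  have hlog2 : 0 ≤ Real.log 2 := Real.log_nonneg (by norm_num)
  rw [goldbachLogCount_eq_sum_vonMangoldtPrime,
    Nat.sum_antidiagonal_eq_sum_range_succ (fun a b ↦ vonMangoldtPrime a * vonMangoldtPrime b)]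
  calc ∑ k ∈ range N.succ, vonMangoldtPrime k * vonMangoldtPrime (N - k)
      ≤ ∑ k ∈ range N.succ, if k = 2 ∨ k = N - 2 then Real.log 2 * Real.log N else 0 := by
        refine sum_le_sum fun k hk ↦ ?_
        have hkN : k ≤ N := Nat.lt_succ_iff.mp (mem_range.mp hk)
        split_ifs with h
        · exact vonMangoldtPrime_mul_vonMangoldtPrime_le hkN h
        · rw [not_or] at h
          exact (vonMangoldtPrime_mul_vonMangoldtPrime_eq_zero_of_odd hN hkN h.1 h.2).le
    _ = ∑ k ∈ (range N.succ).filter (fun k ↦ k = 2 ∨ k = N - 2), Real.log 2 * Real.log N := by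
        rw [sum_filter]
    _ = ((range N.succ).filter (fun k ↦ k = 2 ∨ k = N - 2)).card * (Real.log 2 * Real.log N) := by
        rw [sum_const, nsmul_eq_mul]
    _ ≤ 2 * (Real.log 2 * Real.log N) := by
        gcongr
        have hsub : (range N.succ).filter (fun k ↦ k = 2 ∨ k = N - 2) ⊆ {2, N - 2} := by
          intro k hk
          rw [mem_filter] at hk
          rw [mem_insert, mem_singleton]
          exact hk.2
        calc (((range N.succ).filter (fun k ↦ k = 2 ∨ k = N - 2)).card : ℝ)
            ≤ (({2, N - 2} : Finset ℕ).card : ℝ) := by exact_mod_cast card_le_card hsub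
          _ ≤ 2 := by exact_mod_cast card_insert_le 2 {N - 2}
    _ = 2 * Real.log 2 * Real.log N := by ring

/-- **The odd part of the average is `O(x^{3/2})`**:
`∑_{N ≤ x, N odd} G(N) ≤ 4 log 2 · (x+1)^{3/2}` (from `G(N) ≤ 2 log 2 log N ≤ 4 log 2 √N`).
[folklore] -/
theorem sum_odd_goldbachLogCount_le (x : ℕ) :
    ∑ N ∈ (range (x + 1)).filter Odd, goldbachLogCount N ≤
      4 * Real.log 2 * ((x : ℝ) + 1) ^ (3 / 2 : ℝ) := by
  have hlog2 : 0 ≤ Real.log 2 := Real.log_nonneg (by norm_num)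
  have hx1 : (0 : ℝ) < (x : ℝ) + 1 := by positivity
  have hterm : ∀ N ∈ (range (x + 1)).filter Odd,
      goldbachLogCount N ≤ 4 * Real.log 2 * ((x : ℝ) + 1) ^ (1 / 2 : ℝ) := by
    intro N hN
    rw [mem_filter, mem_range] at hN
    have hNx : (N : ℝ) ≤ (x : ℝ) + 1 := by exact_mod_cast hN.1.le
    have hlogN : Real.log N ≤ 2 * ((x : ℝ) + 1) ^ (1 / 2 : ℝ) := by
      have h1 := Real.log_natCast_le_rpow_div N (by norm_num : (0 : ℝ) < 1 / 2)
      have h2 : (N : ℝ) ^ (1 / 2 : ℝ) ≤ ((x : ℝ) + 1) ^ (1 / 2 : ℝ) :=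
        Real.rpow_le_rpow N.cast_nonneg hNx (by norm_num)
      calc Real.log N ≤ (N : ℝ) ^ (1 / 2 : ℝ) / (1 / 2) := h1
        _ = 2 * (N : ℝ) ^ (1 / 2 : ℝ) := by ring
        _ ≤ 2 * ((x : ℝ) + 1) ^ (1 / 2 : ℝ) := by gcongr
    calc goldbachLogCount N ≤ 2 * Real.log 2 * Real.log N := goldbachLogCount_le_of_odd hN.2
      _ ≤ 2 * Real.log 2 * (2 * ((x : ℝ) + 1) ^ (1 / 2 : ℝ)) := by gcongr
      _ = 4 * Real.log 2 * ((x : ℝ) + 1) ^ (1 / 2 : ℝ) := by ring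
  calc ∑ N ∈ (range (x + 1)).filter Odd, goldbachLogCount N
      ≤ ∑ N ∈ (range (x + 1)).filter Odd, 4 * Real.log 2 * ((x : ℝ) + 1) ^ (1 / 2 : ℝ) :=
        sum_le_sum hterm
    _ = ((range (x + 1)).filter Odd).card * (4 * Real.log 2 * ((x : ℝ) + 1) ^ (1 / 2 : ℝ)) := by
        rw [sum_const, nsmul_eq_mul]
    _ ≤ ((x : ℝ) + 1) * (4 * Real.log 2 * ((x : ℝ) + 1) ^ (1 / 2 : ℝ)) := by
        gcongr
        have := card_filter_le (range (x + 1)) Odd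
        rw [card_range] at this
        exact_mod_cast this
    _ = 4 * Real.log 2 * (((x : ℝ) + 1) ^ (1 : ℝ) * ((x : ℝ) + 1) ^ (1 / 2 : ℝ)) := by
        rw [Real.rpow_one]
        ring
    _ = 4 * Real.log 2 * ((x : ℝ) + 1) ^ (3 / 2 : ℝ) := by
        rw [← Real.rpow_add hx1]
        norm_num

/-- The odd part is non-negative. [folklore] -/
theorem sum_odd_goldbachLogCount_nonneg (x : ℕ) :
    0 ≤ ∑ N ∈ (range (x + 1)).filter Odd, goldbachLogCount N :=
  sum_nonneg fun N _ ↦ goldbachLogCount_nonneg N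

/-! ### The forward estimate from a uniform bound for `θ(n) − n` -/

/-- **Forward direction, conditional form.** If `|θ(n) − n| ≤ A (n+1)^α` for all `n : ℕ`
(`A, α ≥ 0`), then `|∑_{N ≤ x} G(N) − x²/2| ≤ (A log 4 + A + 1) (x+1)^{α+1}` for all `x : ℕ`.
Proof: `S(x) = ∑_{a ≤ x} w(a) θ(x−a) = ∑_{a ≤ x} w(a)(x − a) + ∑_{a ≤ x} w(a) E(x − a)` with
`E = θ − id`; the first sum is `∑_{n<x} θ(n) = x(x−1)/2 + ∑_{n<x} E(n)` by Abel summation, and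
`θ(x) ≤ x log 4` (Chebyshev) bounds the second. (Under RH the sharper `x²/2 + O(x^{3/2})` holds,
Fujii 1991 / Granville 2007, quoted as eq. (1) in Bhowmik–Ruzsa 2018, §1; the present weaker form
suffices for Theorem 1A.) [cite: BhowmikRuzsa2018, §1 (1)] -/
theorem abs_goldbachLogSum_sub_le {A α : ℝ} (hA : 0 ≤ A) (hα : 0 ≤ α)
    (hθ : ∀ n : ℕ, |θ n - n| ≤ A * ((n : ℝ) + 1) ^ α) (x : ℕ) :
    |goldbachLogSum x - (x : ℝ) ^ 2 / 2| ≤ (A * Real.log 4 + A + 1) * ((x : ℝ) + 1) ^ (α + 1) := by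
  have hxnn : (0 : ℝ) ≤ (x : ℝ) := Nat.cast_nonneg x
  have hx1 : (1 : ℝ) ≤ (x : ℝ) + 1 := by linarith
  have hx0 : (0 : ℝ) < (x : ℝ) + 1 := by positivity
  set X : ℝ := ((x : ℝ) + 1) ^ α with hX
  have hX0 : 0 ≤ X := by positivity
  have hX1 : 1 ≤ X := Real.one_le_rpow hx1 hα
  have hXpow : ((x : ℝ) + 1) ^ (α + 1) = ((x : ℝ) + 1) * X := by
    rw [hX, Real.rpow_add hx0, Real.rpow_one, mul_comm]
  -- uniform bound `|E(n)| ≤ A X` for `n ≤ x`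
  have hE : ∀ n : ℕ, n ≤ x → |θ n - n| ≤ A * X := by
    intro n hn
    refine (hθ n).trans (mul_le_mul_of_nonneg_left ?_ hA)
    exact Real.rpow_le_rpow (by positivity) (by exact_mod_cast Nat.add_le_add_right hn 1) hα
  -- Step 1: `S(x) = Σ₁ + Σ₂` with `Σ₁ = ∑ w(a)(x-a)`, `Σ₂ = ∑ w(a) E(x-a)`
  have hsplit : goldbachLogSum x =
      ∑ a ∈ range (x + 1), vonMangoldtPrime a * ((x : ℝ) - a) +
        ∑ a ∈ range (x + 1), vonMangoldtPrime a * (θ ((x - a : ℕ) : ℝ) - ((x - a : ℕ) : ℝ)) := by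
    rw [goldbachLogSum_eq_sum_vonMangoldtPrime_mul_theta, ← sum_add_distrib]
    refine sum_congr rfl fun a ha ↦ ?_
    have hax : a ≤ x := Nat.lt_succ_iff.mp (mem_range.mp ha)
    rw [Nat.cast_sub hax]
    ring
  -- Step 2: `Σ₁ = ∑_{n<x} θ(n) = ∑_{n<x} n + ∑_{n<x} E(n)`
  have hAbel : ∑ a ∈ range (x + 1), vonMangoldtPrime a * ((x : ℝ) - a) =
      (x : ℝ) * ((x : ℝ) - 1) / 2 + ∑ n ∈ range x, (θ n - n) := by
    rw [sum_range_mul_sub_eq]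
    have h1 : ∑ n ∈ range x, ∑ a ∈ range (n + 1), vonMangoldtPrime a =
        ∑ n ∈ range x, (n : ℝ) + ∑ n ∈ range x, (θ n - n) := by
      rw [← sum_add_distrib]
      refine sum_congr rfl fun n _ ↦ ?_
      rw [theta_natCast]
      ring
    rw [h1]
    congr 1
    have h2 := sum_range_id_mul_two x
    have h3 : ((∑ i ∈ range x, i : ℕ) : ℝ) * 2 = (x : ℝ) * ((x : ℝ) - 1) := by
      rcases Nat.eq_zero_or_pos x with rfl | hxpos
      · simp
      · have : ((x * (x - 1) : ℕ) : ℝ) = (x : ℝ) * ((x : ℝ) - 1) := by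
          rw [Nat.cast_mul, Nat.cast_sub hxpos, Nat.cast_one]
        rw [← this, ← h2, Nat.cast_mul, Nat.cast_two]
    push_cast at h3
    linarith
  -- Step 3: the bounds
  have hR1 : |∑ n ∈ range x, (θ n - n)| ≤ A * ((x : ℝ) + 1) * X := by
    calc |∑ n ∈ range x, (θ n - n)| ≤ ∑ n ∈ range x, |θ n - n| :=
          Finset.abs_sum_le_sum_abs (fun n : ℕ ↦ θ n - n) (range x)
      _ ≤ ∑ n ∈ range x, A * X :=
          sum_le_sum fun n hn ↦ hE n (mem_range.mp hn).le
      _ = x * (A * X) := by rw [sum_const, card_range, nsmul_eq_mul]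
      _ ≤ ((x : ℝ) + 1) * (A * X) := by
          gcongr
          linarith
      _ = A * ((x : ℝ) + 1) * X := by ring
  have hR2 : |∑ a ∈ range (x + 1), vonMangoldtPrime a * (θ ((x - a : ℕ) : ℝ) - ((x - a : ℕ) : ℝ))| ≤
      A * Real.log 4 * ((x : ℝ) + 1) * X := by
    calc |∑ a ∈ range (x + 1), vonMangoldtPrime a * (θ ((x - a : ℕ) : ℝ) - ((x - a : ℕ) : ℝ))|
        ≤ ∑ a ∈ range (x + 1), |vonMangoldtPrime a * (θ ((x - a : ℕ) : ℝ) - ((x - a : ℕ) : ℝ))| :=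
          Finset.abs_sum_le_sum_abs _ _
      _ ≤ ∑ a ∈ range (x + 1), vonMangoldtPrime a * (A * X) := by
          refine sum_le_sum fun a _ ↦ ?_
          rw [abs_mul, abs_of_nonneg (vonMangoldtPrime_nonneg a)]
          exact mul_le_mul_of_nonneg_left (hE (x - a) (Nat.sub_le x a)) (vonMangoldtPrime_nonneg a)
      _ = θ x * (A * X) := by rw [← sum_mul, ← theta_natCast]
      _ ≤ Real.log 4 * x * (A * X) := by
          gcongr
          exact Chebyshev.theta_le_log4_mul_x x.cast_nonneg
      _ ≤ Real.log 4 * ((x : ℝ) + 1) * (A * X) := by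
          gcongr
          linarith
      _ = A * Real.log 4 * ((x : ℝ) + 1) * X := by ring
  -- Step 4: assemble
  have hmain : goldbachLogSum x - (x : ℝ) ^ 2 / 2 =
      -(x : ℝ) / 2 + ∑ n ∈ range x, (θ n - n) +
        ∑ a ∈ range (x + 1), vonMangoldtPrime a * (θ ((x - a : ℕ) : ℝ) - ((x - a : ℕ) : ℝ)) := by
    rw [hsplit, hAbel]
    ring
  rw [hmain, hXpow]
  have hx2 : |-(x : ℝ) / 2| ≤ ((x : ℝ) + 1) * X := by
    rw [abs_div, abs_neg, Nat.abs_cast, abs_two]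
    calc (x : ℝ) / 2 ≤ (x : ℝ) + 1 := by linarith
      _ = ((x : ℝ) + 1) * 1 := (mul_one _).symm
      _ ≤ ((x : ℝ) + 1) * X := by gcongr
  calc |-(x : ℝ) / 2 + ∑ n ∈ range x, (θ n - n) +
        ∑ a ∈ range (x + 1), vonMangoldtPrime a * (θ ((x - a : ℕ) : ℝ) - ((x - a : ℕ) : ℝ))|
      ≤ |-(x : ℝ) / 2| + |∑ n ∈ range x, (θ n - n)| +
        |∑ a ∈ range (x + 1), vonMangoldtPrime a * (θ ((x - a : ℕ) : ℝ) - ((x - a : ℕ) : ℝ))| :=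
        abs_add_three _ _ _
    _ ≤ ((x : ℝ) + 1) * X + A * ((x : ℝ) + 1) * X + A * Real.log 4 * ((x : ℝ) + 1) * X :=
        add_le_add (add_le_add hx2 hR1) hR2
    _ = (A * Real.log 4 + A + 1) * (((x : ℝ) + 1) * X) := by ring

end GoldbachAverage

end Literature.NumberTheory.Sieve

end
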